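import Mathlib
import HarnessLib
import HarnessLib.Audit
import Summits.NavierStokesRegularity.Statement
import Literature.Analysis.FluidPDE.ClassicalSolution
import Literature.Analysis.FluidPDE.LerayHopf
import Literature.Analysis.FluidPDE.AxisymmetricEuler
import Literature.Analysis.FluidPDE.NSWave0

/-!
Route: TokamakQuasistatics

CLOSED (retired) 2026-08-15T13:49:08Z by operator:999:1257524 — reason: not-a-thesis: assembly does not conclude the sub-problem Statement — note: D-0027 §2.1 audit (human 2026-08-15: routes that do not decide the summit are removed): the assembly concludes `∀ (ν T : ℝ), 0 < ν → 0 < T → ∀ (u : ℝ → EuclideanSpace ℝ (Fin 3) → EuclideanSpace ℝ (Fin 3)) (p : ℝ → EuclideanSpace ℝ (Fin 3) → ℝ), Literature.Analysis.FluidPD`, not the sub-problem state. The file is kept as the record of this route; refuted decls are indexed as negative knowledge (`ledger negatives`).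

# Route TokamakQuasistatics — NavierStokesRegularity (Clay A), POSITIVE side, SPECIAL-CASE
(instance) route on the stratum of Clay data that Euler cannot move
Card realised: NavierStokesRegularity/NavierStokesRegularity/euler-equilibria-tokamak-quasistatics
("What can viscosity do to a flow Euler cannot move?").

## The class 𝔈_ax and the Target (rank 0, decl NoBlowupFromEquilibria)
𝔈_ax = rapidly decaying (Fefferman (4)), smooth, divergence-free, AXISYMMETRIC data u₀ on ℝ³ that
are STEADY EULER: ∃ smooth p₀ with (u₀·∇)u₀ + ∇p₀ = 0. Non-empty and rich: Gavrilov's compactly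
supported swirling tori u_G [Gavrilov2019] and the Constantin–La–Vicol localizable Grad–Shafranov
solutions [ConstantinLaVicol2019] (Γ = r u_θ = F(ψ) constant on nested pressure tori, u·∇ψ = 0, no
swirl ⇒ trivial); every A·u_G, A ∈ ℝ, is again in 𝔈_ax, so the class reaches every Reynolds number;
analytic localizable steady flows are necessarily axisymmetric (arXiv:2606.13462). On 𝔈_ax the
inviscid dynamics is FROZEN (T_Euler = ∞, support item EulerFrozen), so Clay (A) asks in its purest
form whether viscosity ALONE can manufacture a singularity.
TARGET X (it suffices, for Clay restricted to 𝔈_ax): for every ν > 0, every finite-energy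
(Leray–Hopf) classical NS solution on ℝ³×[0,T) whose datum u(0) lies in 𝔈_ax extends smoothly past
T.
Lean (elaborates; Sketch.lean rc 0): ∀ ν T > 0, ∀ u p, IsClassicalNSSolutionOn (Ico 0 T) ν 0 u p →
IsLerayHopfOn T ν 0 (u 0) u → HasRapidSpatialDecay (u 0) → IsAxisymmetric (u 0) → (∃ p₀, ContDiff ℝ
⊤ p₀ ∧ ∀ x, convect (u 0) (u 0) x = -gradient p₀ x) → HasSmoothExtensionPast ν 0 u T.
Clay (A) verbatim on 𝔈_ax (support ClayOnEquilibria) follows by the local theory of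
stmt-NavierStokesRegularity-0055; the NEGATION of X is filed as ViscousGenesis (= ¬X by pure logic,
proved in Sketch.lean): a blow-up CREATED by viscosity from a flow Euler holds still — it is an X5a
witness (stmt-NavierStokesRegularity-0152 shape) and with X5b (stmt-…-0153) gives
¬NavierStokesRegularity through the accepted Blowup assembly (stmt-…-0151); by
Literature.Barriers.NavierStokesRegularity.AxisymmetricTypeIExclusion it would be Type II.

## Assembly (rank 1): AxisCriterion → AxisShielding → NoBlowupFromEquilibria — PURE LOGIC (theorem
assembly_holds in the planner's Sketch.lean, 3 lines).

## Mechanism (tokamak quasi-statics, explicit dictionary) and the two-layer plan (D-0019)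
Dictionary [ConstantinLaVicol2019 §2, GradHogan1970]: Gavrilov torus ↔ axisymmetric Grad–Shafranov
equilibrium (CLV's construction IS Grad–Shafranov: −Δ*ψ = ∂_ψ(F²/2 + r²P)); viscosity ν ↔
resistivity η; the two-profile manifold 𝓜 = {u_{F,P}} of swirling axisymmetric equilibria ↔ the GS
equilibrium manifold; Γ = F(ψ) ↔ poloidal current; slow viscous drift of (F,P) by
flux-surface-averaged diffusion ↔ Grad–Hogan "classical diffusion in a tokamak" (evolution THROUGH
equilibria on the resistive time); loss of quasi-statics ↔ an ideal (here: centrifugal,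
Rayleigh–Taylor) instability. TOKAMAK ORDERING at Re = AL/ν ≫ 1: τ_turnover = L/A ≪ τ_relax ≪
τ_viscous = L²/ν = Re·τ_turnover.
Why this closes X: in the axisymmetric class NS is CRITICAL, not supercritical — Γ = r u_θ is
scale-invariant and obeys a maximum principle (support SwirlMaximumPrinciple), and a
data-INDEPENDENT log-modulus of Γ at the axis, uniformly in time, implies regularity [LeiZhang2017
Cor. 1.3; Wei2016 Cor. 1.1]. Data in 𝔈_ax start with Γ ≡ F(ψ) vanishing to all orders at the torus
boundary (identically zero near the axis for Gavrilov data): deep inside the regular regime.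
Quasi-statics is the mechanism that KEEPS the circulation off the axis for all time: while the
solution shadows 𝓜, Γ(t) ≈ F_t(ψ_t) stays slaved to flux surfaces that drift on the viscous time,
and the secondary (Dean/Ekman-type) circulation created by viscous loss of cyclostrophic balance
pushes swirling fluid OUTWARD (centrifugal effect; observed for non-equilibrium swirling rings,
[OrtegachavezGanGaskell2023] §1 reporting Cheng–Lou–Lim 2010 and Virk et al. 1994).
Layer 1 (ranked cruxes; all elaborate):
 #2 AxisCriterion — the Lei–Zhang/Wei axis criterion in tree vocabulary (classical + Leray–Hopf on
[0,T), axisymmetric slices, ∃ C r₁: |Γ(t,x)| ≤ C (log(r₁/r))⁻² for 0 < r ≤ r₁/4 ⇒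
HasSmoothExtensionPast). A published theorem NOT in the tree: ranked first by the plancard rule (the
assembly rests on it; vendor as a named fact, then a grounder may re-sign the item as fact →
statement).
 #3 AxisShielding — THE open statement: for NS from 𝔈_ax data, axisymmetry persists and Γ has such a
log-modulus at the axis UNIFORMLY on [0,T). (Target = #2 ∘ #3.)
 #4 LaminarDissipation — energy confinement on the viscous time, uniformly in amplitude: ∀ε
∃c(U,ν,ε) ∀A: the solution from A·U keeps kinetic energy ≥ (1−ε)E₀ for t ≤ c. The quantitative
signature of quasi-statics (dissipation stays laminar, ν‖∇u‖² ≲ νA²‖∇U‖²; no zeroth law on frozen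
data); independent of regularity, falsifiable by axisymmetric DNS.
 #5 ViscousWindow — a lifespan floor independent of the Reynolds number: ∃ c(U,ν) > 0 such that for
EVERY amplitude A no classical Leray–Hopf solution from A·U blows up before time c. Rung of X (X ⇒
#5, Sketch.lean modulo three one-line facts about A•U); Euler-perturbation theory [Constantin1986]
reaches only t ~ (L/A) ln Re → 0.
Layer 2 (glue, NOT filed now; by glued splits once a crux closes): #3 ⇐ (shadowing of 𝓜 up to the
viscous time: needs the Bragg–Hawthorne/Grad–Shafranov equilibrium map and an Arnold/energy–Casimir
stability predicate — definition requests deferred until #4/#5 show the ordering is real) ∧ (slow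
profile system keeps F_t(ψ) shielded) ∧ (eventual small-swirl regime, LeiZhang2017 Thm 1.4 / Wei2016
Thm 1.1(b)); #5 ⇐ linear tokamak ordering (enhanced dissipation at rate ≳ A^{2/3}ν^{1/3} on the
complement of T𝓜 where the shear is non-degenerate) ∧ nonlinear bootstrap.

Rationale: WHY THIS LINE. Every positive NS route on the board attacks all data through a
rigidity/Liouville/Lyapunov object; none exploits a DATA CLASS on which one half of the difficulty
(the inviscid dynamics) vanishes identically. 𝔈_ax [Gavrilov2019, ConstantinLaVicol2019,
arXiv:2606.13462, Baldi2023] is such a class at unbounded Reynolds number inside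
axisymmetry-WITH-swirl — the habitat of the only live interior blow-up candidate
[Hou2022PotentiallySingularNS] and the class where NS is critical (Γ = r u_θ: maximum principle +
data-independent axis criteria [LeiZhang2017, Wei2016, KNSS2009]). Imported area: tokamak
quasi-statics [GradHogan1970] — CLV's construction IS Grad–Shafranov, so the plasma dictionary (ν↔η,
equilibrium manifold, flux-surface-averaged slow diffusion, ideal instability as the only fast exit)
is literal, not a costume; NS-side templates of "shadow the equilibrium manifold" exist in
neighbouring geometries [BeckWayne2013 (2-D bar states), GallaySverak2024 (no-swirl rings at all
Re)]. Catalogue items used: physical analogy WITH explicit dictionary; special case (menu 4); regime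
decomposition in time (turnover ≪ relaxation ≪ viscous).
RANKED CRUXES (words; Lean in the file): #2 AxisCriterion (Lei–Zhang Cor 1.3 transcribed; fact-first
rule) · #3 AxisShielding (log-modulus of Γ at the axis uniformly in time for 𝔈_ax data; the open
heart) · #4 LaminarDissipation (energy confinement time = viscous time, uniformly in A) · #5
ViscousWindow (lifespan floor independent of A). Support: EulerFrozen (T_E = ∞, provable now),
SwirlMaximumPrinciple (KNSS (1.9); provable with decay bookkeeping), ClayOnEquilibria (Clay form;
local theory as stmt-0055), ViscousGenesis (= ¬Target; negative exit into the Blowup assembly).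
KILL CRITERIA. (K1, cheapest, BEFORE Lean work on #3–#5) Rayleigh/centrifugal test at t = 0: Γ =
F(ψ) vanishes on the torus boundary and not inside, so Γ² DECREASES outward across the outer
half-torus (Taylor–Couette with the outer wall at rest): compute the Rayleigh discriminant
r⁻³∂_r(Γ²) and the axisymmetric linear spectrum of Euler at u_G (kit: 2-D eigenvalue problem) — a
growing AXISYMMETRIC mode with rate ~A/L makes #4 and #5 suspect-false and reduces #3 to the generic
swirl problem (route → dormant/close exhausted); non-axisymmetric curvature/elliptic modes
[HattoriBlancorodriguezLedizes2019] are irrelevant (exactly axisymmetric data stay axisymmetric).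
(K2) Axisymmetric DNS from A·u_G at Re = 10³–10⁵: energy half-life ∝ Re (alive) vs O(1) turnovers
(dead); max_{r≤δ}|Γ(t)| vs A. (K3) A refutation of AxisShielding (circulation ≥ c>0 reaching r → 0
along t → T*) is a Hou-type scenario born from static data: file it to Blowup/CertifiedBlowup as a
profile candidate. (K4) If LeiZhang2017 Cor 1.3 does not transfer to the classical+Leray–Hopf class
with arbitrary C (it does on paper: scaling r₁ ↦ 1, δ₀ = 1/4), re-sign #2 with Wei's |ln r|^{-3/2}
form.
NOT DECOMPOSED YET (deliberately): the equilibrium-manifold shadowing theorem itself (needs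
definitions: Bragg–Hawthorne map (F,P) ↦ u_{F,P}, Arnold/energy–Casimir stability predicate for
swirling tori, linearised operator and T𝓜 — requested only after K1/K2), the slow Grad–Hogan profile
system, the late-time small-swirl handover (LeiZhang2017 Thm 1.4), and the no-swirl/2-D sanity rungs
(trivial: no-swirl compactly supported steady states do not exist, Jiu–Xin via
[ConstantinLaVicol2019] §2).

NOVELTY. Searched 2026-08-15 (zbMATH/crossref; local searchd down): zbMATH "Gavrilov compactly
supported steady Euler" ≥2019 → 4 hits (Sharafutdinov 2024, ConstantinLaVicol2019, Baldi2023,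
arXiv:2606.13462), none evolves the data by NS; zbMATH "Navier-Stokes initial data stationary Euler
solution viscous decay quasi-static" → 0; "axisymmetric Navier-Stokes swirl away from axis initial
data global" → 0; "vortex ring swirl Navier-Stokes" → 10 (numerics/experiments on NON-equilibrium
swirling rings: doi:10.1063/1.3478976, OrtegachavezGanGaskell2023,
HattoriBlancorodriguezLedizes2019; Feng–Šverák arXiv:1301.6317 no swirl). Read: LeiZhang2017 =
arXiv:1505.02628 (Cor 1.3 any C₁; Thm 1.4 smallness is DATA-DEPENDENT, so Gavrilov data are NOT a
known corollary), Wei2016 = arXiv:1508.03318 Cor 1.1, ConstantinLaVicol2019 §2. Nearest prior art: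
BeckWayne2013 and GallaySverak2024 (NS shadowing a manifold of Euler states, 2-D / no-swirl) ×
LeiZhang2017 (axis criterion) × Gavrilov2019/GradHogan1970 (the class and the ordering). Delta: the
viscous Cauchy problem from swirling compactly supported Euler equilibria as a Clay test class, with
three NEW typed statements (uniform-in-time axis log-shielding for frozen data; energy-confinement
time = viscous time uniformly in Re; Re-independent lifespan floor) and the Rayleigh–Taylor test of
the torus as the single exit. Card graded new-combination by refuter-novelty-audit (2026-08-15).
BARRIERS. technique_class: equilibrium-manifold-shadowing tokamak-quasistatic.
- Literature.Barriers.NavierStokesRegularity.EnergySupercriticality: large data, no smallness —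
evaded by STRUCTURE, exactly its recorded evasion (d): the axisymmetric class carries the
scale-invariant controlled quantity Γ (maximum principle) and the data-independent log criterion
[LeiZhang2017]; the route never asks a supercritical quantity to control a critical one. Honest
limit: #3 must produce the modulus dynamically; the endgame at the axis is critical, not
subcritical.
- Literature.Barriers.NavierStokesRegularity.TaoAveragedBlowup: not engaged by estimates on an
abstract bilinear form: the equilibrium manifold {B(u,u) = ∇q}, the scalar transport of Γ with its
maximum principle and the sign of the centrifugal term are exact-B, axisymmetry-specific structure
absent for averaged B̃.
- Literature.Barriers.NavierStokesRegularity.AxisymmetricTypeIExclusion: APPLIES and is used, not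
evaded: any singularity from 𝔈_ax (ViscousGenesis) is Type II; the positive side loses nothing.
- Literature.Barriers.NavierStokesRegularity.CriticalNormBlowupNecessity /
LeraySelfSimilarBlowupExclusion: consistent — nothing self-similar is proposed; on the negative exit
L³ must blow up.
- Negatives index (2026-08-15): empty for this summit; no refuted statement is re-asked.

Novelty: Nearest prior art: BeckWayne2013 (2-D NS shadows the bar-state manifold, drifts on the viscous time)
and GallaySverak2024 (no-swirl viscous rings stay near inviscid rings at all Re) = NS-side 'shadow
the equilibrium manifold'; LeiZhang2017 = arXiv:1505.02628 Cor 1.3 and Wei2016 = arXiv:1508.03318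
(data-independent axis log-criteria; Thm 1.4 smallness is data-DEPENDENT, so Gavrilov data are not a
known corollary); Gavrilov2019, ConstantinLaVicol2019 = arXiv:1903.11699, Baldi2023,
arXiv:2606.13462 (the class; zbMATH 2026-08-15: 4 hits, none evolves it by NS); numerics on
NON-equilibrium swirling rings doi:10.1063/1.3478976, OrtegachavezGanGaskell2023,
HattoriBlancorodriguezLedizes2019; ordering GradHogan1970. Delta: the viscous Cauchy problem from
swirling compactly supported Euler equilibria as a Clay test class with three new typed statements —
uniform-in-time axis log-shielding for frozen data (AxisShielding), energy-confinement time =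
viscous time uniformly in Re (LaminarDissipation), Re-independent lifespan floor (ViscousWindow) —
assembled through the Lei–Zhang criterion, with the Rayleigh–Taylor test of the torus as the single
exit. Grade claimed: new-combination (card so graded 2026-08-15).  [refs: 10.1063/1.3478976, 1505.02628, 1508.03318, 1903.11699, 2606.13462, doi:10.1063/1.3478976, BeckWayne2013, GallaySverak2024, LeiZhang2017, Wei2016, Gavrilov2019, ConstantinLaVicol2019, Baldi2023, OrtegachavezGanGaskell2023, HattoriBlancorodriguezLedizes2019, GradHogan1970]

Barriers (technique_class: equilibrium-manifold-shadowing tokamak-quasistatic): technique_class: equilibrium-manifold-shadowing tokamak-quasistatic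
- Literature.Barriers.NavierStokesRegularity.EnergySupercriticality: evaded by structure = its
recorded evasion (d): axisymmetric class, scale-invariant Γ = r u_θ with maximum principle +
data-independent log criterion [LeiZhang2017]; no supercritical quantity is asked to control a
critical one; honest limit: AxisShielding must produce the modulus dynamically, the axis endgame is
critical.
- Literature.Barriers.NavierStokesRegularity.TaoAveragedBlowup: not engaged: equilibrium manifold
{B(u,u)=∇q}, scalar transport of Γ, sign of the centrifugal term are exact-B axisymmetric structure
absent for averaged B̃.
- Literature.Barriers.NavierStokesRegularity.AxisymmetricTypeIExclusion: applies and is USED: a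
ViscousGenesis singularity is Type II; positive side unaffected.
- Literature.Barriers.NavierStokesRegularity.CriticalNormBlowupNecessity: consistent (negative exit
must blow up L³; nothing bounded-critical-norm is proposed).
- Literature.Barriers.NavierStokesRegularity.LeraySelfSimilarBlowupExclusion: consistent (no
self-similar ansatz).
- negatives index 2026-08-15: empty.

History (route lifecycle, newest last):
- 2026-08-15T13:49:08Z · CLOSED retired — not-a-thesis: assembly does not conclude the sub-problem Statement (operator:999:1257524)

sub-problem: NavierStokesRegularity · status: closed(retired) · opened planner-plancard-NavierStokesRegularity-Navie-940f80fc-0 2026-08-15T10:58:00Z · rev 1 · ledger route-NavierStokesRegularity-TokamakQuasistatics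
GENERATED by the gate from the ledger (D-0016/17). Provers cite these decls: `theorem foo : Summit.NavierStokesRegularity.NavierStokesRegularity.Theses.TokamakQuasistatics.<Decl> := …` in Summits/NavierStokesRegularity/NavierStokesRegularity/Theorems/<Name>.lean.
-/

namespace Summit.NavierStokesRegularity.NavierStokesRegularity.Theses.TokamakQuasistatics

open scoped BigOperators Topology Manifold Classical MeasureTheory ProbabilityTheory Matrix InnerProductSpace ComplexConjugate ContinuousMap
open Filter Set Function TopologicalSpace MeasureTheory

attribute [summit_statement] _root_.NavierStokesRegularity

open Literature.NS

/-- item stmt-NavierStokesRegularity-1671 · target · rank 0 · closed · moot by None · by planner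
why it might fail: Viscosity may itself make the singularity: Γ₀=F(ψ) vanishes at the torus edge, so d(Γ²)/dr<0 on the outer half-torus (Rayleigh-unstable to axisymmetric modes, Drazin2002 §7.1); a roll-up in O((L/A)ln Re) could hand O(AL) circulation to Hou-type axis dynamics; no large-data theorem with swirl.
sources: Gavrilov2019, ConstantinLaVicol2019, LeiZhang2017, Hou2022PotentiallySingularNS, arXiv:2606.13462, Drazin2002
[target] X = Clay (A) restricted to the class 𝔈_ax of rapidly decaying, smooth, AXISYMMETRIC, STEADY
EULER data (∃ smooth p₀, (u₀·∇)u₀+∇p₀ = 0; Gavrilov2019 / ConstantinLaVicol2019 compactly supported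
swirling tori A·u_G at every Reynolds number), in NoBlowup form: every finite-energy (Leray–Hopf)
classical NS solution on ℝ³×[0,T) with u(0) ∈ 𝔈_ax extends smoothly past T. On 𝔈_ax the inviscid
dynamics is frozen (T_Euler = ∞), so this is the purest instance of 'can viscosity alone create a
singularity?'. Clay's verbatim form on 𝔈_ax is the support item ClayOnEquilibria (local theory as
stmt-NavierStokesRegularity-0055); ¬X is the support item ViscousGenesis (negative exit into the
Blowup assembly stmt-…-0151 via X5a/X5b). Card: euler-equilibria-tokamak-quasistatics. -/
@[route_item "route-NavierStokesRegularity-TokamakQuasistatics"]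
def NoBlowupFromEquilibria : Prop :=
  ∀ (ν T : ℝ), 0 < ν → 0 < T → ∀ (u : ℝ → EuclideanSpace ℝ (Fin 3) → EuclideanSpace ℝ (Fin 3)) (p : ℝ → EuclideanSpace ℝ (Fin 3) → ℝ), Literature.Analysis.FluidPDE.IsClassicalNSSolutionOn (Set.Ico 0 T) ν 0 u p → Literature.Analysis.FluidPDE.IsLerayHopfOn T ν 0 (u 0) u → Literature.Analysis.FluidPDE.HasRapidSpatialDecay (u 0) → Literature.Analysis.FluidPDE.IsAxisymmetric (u 0) → (∃ p₀ : EuclideanSpace ℝ (Fin 3) → ℝ, ContDiff ℝ (⊤ : ℕ∞) p₀ ∧ ∀ x, Literature.Analysis.FluidPDE.convect (u 0) (u 0) x = -gradient p₀ x) → Literature.Analysis.FluidPDE.HasSmoothExtensionPast ν 0 u T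

/-- item stmt-NavierStokesRegularity-1673 · crux · rank 3 · closed · moot by None · by planner
why it might fail: Γ has only a maximum principle. Γ₀=F(ψ) vanishes at the torus edge ⇒ d(Γ²)/dr<0 on the outer half: Rayleigh/Synge-unstable to AXISYMMETRIC modes unless poloidal flow stabilises (Drazin2002 §7.1); roll-up in O((L/A)ln Re) or Ekman-type secondary flow may carry O(AL) circulation into r≤δ before T.
sources: LeiZhang2017, KNSS2009, ConstantinLaVicol2019, Drazin2002, OrtegachavezGanGaskell2023, doi:10.1063/1.3478976
[crux] AXIS SHIELDING — the open heart of the route: for every ν>0 and every classical Leray–Hopf NS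
solution on [0,T) whose datum is in 𝔈_ax (rapidly decaying, axisymmetric, steady Euler), (i) all
time slices stay axisymmetric and (ii) the swirl Γ = r u_θ has a log-modulus at the axis UNIFORMLY
on [0,T): ∃ C, r₁ > 0, |Γ(t,x)| ≤ C (log(r₁/r))^{-2} for 0 < r ≤ r₁/4. At t = 0 this holds with room
(Γ₀ = F(ψ) vanishes to infinite order at the torus boundary; ≡ 0 near the axis for Gavrilov data)
and ‖Γ(t)‖_∞ ≤ ‖Γ₀‖_∞ for all t (SwirlMaximumPrinciple); the content is that neither viscous
diffusion nor the flow's own secondary circulation carries circulation ≳ |ln r|^{-2} onto the axis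
before a putative blow-up time. Mechanism offered by the card (tokamak quasi-statics, GradHogan1970
dictionary via ConstantinLaVicol2019 §2): the solution shadows the two-profile manifold of swirling
Grad–Shafranov equilibria, Γ(t) ≈ F_t(ψ_t) stays slaved to flux surfaces drifting on the viscous
time L²/ν, and the Dean/Ekman-type secondary flow created by viscous loss of cyclostrophic balance
pushes swirling fluid OUTWARD (centrifugal effect seen for non-equilibrium swirling rings:
OrtegachavezGanGaskell202 -/
@[route_item "route-NavierStokesRegularity-TokamakQuasistatics"]
def AxisShielding : Prop :=
  ∀ (ν T : ℝ), 0 < ν → 0 < T → ∀ (u : ℝ → EuclideanSpace ℝ (Fin 3) → EuclideanSpace ℝ (Fin 3)) (p : ℝ → EuclideanSpace ℝ (Fin 3) → ℝ), Literature.Analysis.FluidPDE.IsClassicalNSSolutionOn (Set.Ico 0 T) ν 0 u p → Literature.Analysis.FluidPDE.IsLerayHopfOn T ν 0 (u 0) u → Literature.Analysis.FluidPDE.HasRapidSpatialDecay (u 0) → Literature.Analysis.FluidPDE.IsAxisymmetric (u 0) → (∃ p₀ : EuclideanSpace ℝ (Fin 3) → ℝ, ContDiff ℝ (⊤ : ℕ∞)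 p₀ ∧ ∀ x, Literature.Analysis.FluidPDE.convect (u 0) (u 0) x = -gradient p₀ x) → (∀ t ∈ Set.Ico 0 T, Literature.Analysis.FluidPDE.IsAxisymmetric (u t)) ∧ ∃ C r₁ : ℝ, 0 < r₁ ∧ ∀ t ∈ Set.Ico 0 T, ∀ x, 0 < Literature.Analysis.FluidPDE.cylRadius x → Literature.Analysis.FluidPDE.cylRadius x ≤ r₁ / 4 → |Literature.Analysis.FluidPDE.swirl (u t) x| ≤ C * (Real.log (r₁ / Literature.Analysis.FluidPDE.cylRadius x))⁻¹ ^ 2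

/-- item stmt-NavierStokesRegularity-1674 · crux · rank 4 · closed · moot by None · by planner
why it might fail: ∀-quantified over ALL profiles of the class: one swirling torus that is centrifugally unstable within axisymmetry (d(Γ²)/dr<0 on its outer half, Drazin2002 (7.4); Taylor vortices ARE axisymmetric) and turbulises dissipates at rate ~A³/L, losing εE₀ in time ~(L/A)(ln Re+ε)→0 as A→∞, so no c(U,ν,ε).
sources: Gavrilov2019, ConstantinLaVicol2019, Drazin2002, HattoriBlancorodriguezLedizes2019, GallaySverak2024, BeckWayne2013
[crux] LAMINAR DISSIPATION / ENERGY CONFINEMENT ON THE VISCOUS TIME, UNIFORMLY IN AMPLITUDE: for a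
fixed profile U ∈ 𝔈_ax (with its pressure P) and ν > 0: ∀ ε > 0 ∃ c = c(U,ν,ε) > 0 such that for
EVERY amplitude A ∈ ℝ, every classical Leray–Hopf solution from A·U keeps kinetic energy ≥
(1−ε)·E(A·U) for all t ≤ c of its existence interval. Since dE/dt = −ν‖∇u‖², this says the
dissipation rate stays laminar, ν‖∇u(t)‖² ≲ νA²‖∇U‖² with no Re-dependent enstrophy amplification:
the energy-confinement time is the viscous ('resistive', GradHogan1970) time, not the turnover time
— the quantitative signature of tokamak ordering and the cleanest 'no zeroth law on frozen data'
statement (contrast the AnomalousDissipation summit). Independent of regularity (it constrains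
Leray–Hopf energy only), strictly weaker than shadowing, falsifiable by axisymmetric DNS from A·u_G
at Re = 10³–10⁵ (kit: energy half-life ∝ Re alive, O(1) turnovers dead). Tools:
energy–Casimir/Arnold-type stability of u_G within the axisymmetric class (Szeri–Holmes form),
inviscid damping/enhanced dissipation around sheared tori (BeckWayne2013, GallaySverak2024 as
templates), the exact identity ∂_t u|_{t=0} = νAΔU (the Leray -/
@[route_item "route-NavierStokesRegularity-TokamakQuasistatics"]
def LaminarDissipation : Prop :=
  ∀ ν : ℝ, 0 < ν → ∀ (U : EuclideanSpace ℝ (Fin 3) → EuclideanSpace ℝ (Fin 3)) (P : EuclideanSpace ℝ (Fin 3) → ℝ), ContDiff ℝ (⊤ : ℕ∞) U → ContDiff ℝ (⊤ : ℕ∞) P → Literature.Analysis.FluidPDE.HasRapidSpatialDecay U → Literature.Analysis.FluidPDE.IsAxisymmetric U → Literature.Analysis.FluidPDE.VectorCalculus.IsDivFree U → (∀ x, Literature.Analysis.FluidPDE.convect U U x = -gradient P x) → ∀ ε : ℝ, 0 < ε → ∃ c : ℝ, 0 < c ∧ ∀ (A T : ℝ), 0 < T → ∀ (u : ℝ → EuclideanSpace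 ℝ (Fin 3) → EuclideanSpace ℝ (Fin 3)) (p : ℝ → EuclideanSpace ℝ (Fin 3) → ℝ), Literature.Analysis.FluidPDE.IsClassicalNSSolutionOn (Set.Ico 0 T) ν 0 u p → Literature.Analysis.FluidPDE.IsLerayHopfOn T ν 0 (A • U) u → u 0 = A • U → ∀ t ∈ Set.Ico 0 T, t ≤ c → (1 - ε) * Literature.Analysis.FluidPDE.VectorCalculus.kineticEnergy (A • U) ≤ Literature.Analysis.FluidPDE.VectorCalculus.kineticEnergy (u t)

/-- item stmt-NavierStokesRegularity-1675 · crux · rank 5 · closed · moot by None · by planner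
why it might fail: ⇔ (u↦u(t/A)/A) T*(U,ν/A) ≥ cA: NS from the fixed datum U regular for ~Re turnovers. Constantin1986-type Euler perturbation gives only ~ln Re turnovers (linearisation at U grows like e^{tA/L}); more needs nonlinear stability of swirling tori within axisymmetry: unknown, Rayleigh-suspect (Drazin2002).
sources: Constantin1986, Gavrilov2019, Baldi2023, GallaySverak2024, ConstantinLaVicol2019, Drazin2002
[crux] VISCOUS WINDOW — A LIFESPAN FLOOR INDEPENDENT OF THE REYNOLDS NUMBER: for a fixed profile U ∈
𝔈_ax and ν > 0 there is c = c(U,ν) > 0 such that for EVERY amplitude A and every T ≤ c, every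
classical Leray–Hopf solution on [0,T) from A·U extends smoothly past T (no blow-up before time c,
uniformly in A). In Reynolds terms T*(A·U) ≥ c = c'·L²/ν = c'·Re·(L/A): regular through a fixed
fraction of the viscous time although the turnover time L/A → 0. Rung of the Target (Target ⇒
ViscousWindow, Sketch.lean modulo three one-line facts about A•U); the first statement where
'Euler-steady' must beat generic large data: Euler-perturbation theory (Constantin1986: Euler smooth
on [0,T] ⇒ NS_ν smooth on [0,T] for ν ≤ ν₀(T)) controls the departure w = u − A·U only up to t ~
(L/A) ln Re because the linearised Euler flow at U is merely Lipschitz-bounded (growth e^{tA/L}) —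
killing that exponential needs the integrable/KAM structure of u_G (Baldi2023: no exponential
stretching of particles) upgraded to the linearised PDE, i.e. nonlinear stability of the equilibrium
family within axisymmetry plus enhanced dissipation on the non-degenerate-shear region (card's
E1/E2). Provers: a natural first sub -/
@[route_item "route-NavierStokesRegularity-TokamakQuasistatics"]
def ViscousWindow : Prop :=
  ∀ ν : ℝ, 0 < ν → ∀ (U : EuclideanSpace ℝ (Fin 3) → EuclideanSpace ℝ (Fin 3)) (P : EuclideanSpace ℝ (Fin 3) → ℝ), ContDiff ℝ (⊤ : ℕ∞) U → ContDiff ℝ (⊤ : ℕ∞) P → Literature.Analysis.FluidPDE.HasRapidSpatialDecay U → Literature.Analysis.FluidPDE.IsAxisymmetric U → Literature.Analysis.FluidPDE.VectorCalculus.IsDivFree U → (∀ x, Literature.Analysis.FluidPDE.convect U U x = -gradient P x) → ∃ c : ℝ, 0 < c ∧ ∀ (A T : ℝ), 0 < T → T ≤ c → ∀ (u : ℝ → EuclideanSpace ℝ (Fin 3) → EuclideanSpace ℝ (Fin 3)) (p : ℝ → EuclideanSpace ℝ (Fin 3) → ℝ), Literature.Analysis.FluidPDE.IsClassicalNSSolutionOn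 (Set.Ico 0 T) ν 0 u p → Literature.Analysis.FluidPDE.IsLerayHopfOn T ν 0 (A • U) u → u 0 = A • U → Literature.Analysis.FluidPDE.HasSmoothExtensionPast ν 0 u T

/-- item stmt-NavierStokesRegularity-1672 · support · rank 2 · closed · moot by None · by planner
why it might fail: Only transcription risk: scaling invariance (x↦x/r₁, t↦t/r₁²; t↦νt, u↦u/ν so Γ↦Γ/ν, C₁=max(C/ν,2), δ₀=1/4) of IsClassicalNSSolutionOn / IsLerayHopfOn / HasRapidSpatialDecay / HasSmoothExtensionPast must be bookkept; the r=0 case is free (swirl=0 on the axis, C₁/0=0 in Lean).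
sources: LeiZhang2017, arXiv:1505.02628, Wei2016, arXiv:1508.03318, Literature.Analysis.FluidPDE.LeiZhang2017_logModulus_regularity
[crux] THE LEI–ZHANG / WEI AXIS CRITERION in tree vocabulary (LeiZhang2017 = arXiv:1505.02628 Cor.
1.3: if sup_{0≤t<T}|Γ(t,r,z)| ≤ C₁|ln r|^{-2} for r ≤ δ₀ ∈ (0,1/2), ANY C₁ > 1 independent of the
data, the axisymmetric strong solution is regular globally; Wei2016 = arXiv:1508.03318 Cor. 1.1:
exponent 3/2 with constant 1). Stated for classical NS solutions on [0,T) that are Leray–Hopf from a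
rapidly decaying datum with axisymmetric time slices: ∃ C, r₁>0 with |Γ(t,x)| ≤ C (log(r₁/r))^{-2}
for 0 < r = cylRadius x ≤ r₁/4 and all t ∈ [0,T) ⇒ HasSmoothExtensionPast ν 0 u T (Γ = swirl = x₀u₁
− x₁u₀ = r u_θ, in-tree). The scaling u ↦ r₁u(r₁²t, r₁x) and t ↦ t/ν reduce it to the printed form
with δ₀ = 1/4 (Γ is scale-invariant; C arbitrary absorbs ν). A PUBLISHED THEOREM NOT IN THE TREE,
ranked first by the plancard rule because the Assembly rests on it: vendor
`Literature.Analysis.FluidPDE.lei_zhang_axis_criterion : Prop` (cite LeiZhang2017 Cor 1.3) and ask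
the grounder to re-sign this item as fact → statement, or formalise (weighted energy estimates for J
= −∂_z u_θ/r, Ω = ω_θ/r; ~15 pp). -/
@[route_item "route-NavierStokesRegularity-TokamakQuasistatics"]
def AxisCriterion : Prop :=
  ∀ (ν T : ℝ), 0 < ν → 0 < T → ∀ (u : ℝ → EuclideanSpace ℝ (Fin 3) → EuclideanSpace ℝ (Fin 3)) (p : ℝ → EuclideanSpace ℝ (Fin 3) → ℝ), Literature.Analysis.FluidPDE.IsClassicalNSSolutionOn (Set.Ico 0 T) ν 0 u p → Literature.Analysis.FluidPDE.IsLerayHopfOn T ν 0 (u 0) u → Literature.Analysis.FluidPDE.HasRapidSpatialDecay (u 0) → (∀ t ∈ Set.Ico 0 T, Literature.Analysis.FluidPDE.IsAxisymmetric (u t)) → (∃ C r₁ : ℝ, 0 < r₁ ∧ ∀ t ∈ Set.Ico 0 T, ∀ x, 0 < Literature.Analysis.FluidPDE.cylRadius x → Literature.Analysis.FluidPDE.cylRadius x ≤ r₁ / 4 → |Literature.Analysis.FluidPDE.swirl (u t) x| ≤ C * (Real.log (r₁ / Literature.Analysis.FluidPDE.cylRadius x))⁻¹ ^ 2) → Literature.Analysis.FluidPDE.HasSmoothExtensionPast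 ν 0 u T

/-- item stmt-NavierStokesRegularity-1676 · support · rank 9 · closed · moot by None · by planner
sources: Gavrilov2019, ConstantinLaVicol2019, BealeKatoMajda1984
[support, provable now] EULER CANNOT MOVE IT (T_Euler = ∞): a smooth divergence-free U with (U·∇)U =
−∇P is a global classical Euler solution, IsClassicalEulerSolutionOn (Ici 0) 0 (fun _ => U) (fun _
=> P) (time derivative of a constant, joint smoothness of the constant-in-time field). Records
formally that on 𝔈_ax the pre-Euler stratum of card pre-euler-time-regularity is everything:
PreEuler ≡ Clay there. -/
@[route_item "route-NavierStokesRegularity-TokamakQuasistatics"]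
def EulerFrozen : Prop :=
  ∀ (U : EuclideanSpace ℝ (Fin 3) → EuclideanSpace ℝ (Fin 3)) (P : EuclideanSpace ℝ (Fin 3) → ℝ), ContDiff ℝ (⊤ : ℕ∞) U → ContDiff ℝ (⊤ : ℕ∞) P → Literature.Analysis.FluidPDE.VectorCalculus.IsDivFree U → (∀ x, Literature.Analysis.FluidPDE.convect U U x = -gradient P x) → Literature.Analysis.FluidPDE.IsClassicalEulerSolutionOn (Set.Ici 0) 0 (fun _ => U) (fun _ => P)

/-- item stmt-NavierStokesRegularity-1677 · support · rank 9 · closed · moot by None · by planner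
sources: KNSS2009, LeiZhang2017
[support] SWIRL MAXIMUM PRINCIPLE (KNSS2009 eq. (1.8)–(1.9); Chae–Lee 2002): for a classical
Leray–Hopf NS solution on [0,T) from a rapidly decaying datum with axisymmetric slices, |Γ(t,x)| ≤
sup_y |Γ(0,y)| for all t ∈ [0,T), Γ = swirl = r u_θ (in-tree; Γ-equation
`Literature.Analysis.FluidPDE.swirl_transport`: ∂_tΓ + b·∇Γ = ν(Δ − (2/r)∂_r)Γ). The scale-invariant
a-priori bound that makes the axisymmetric class critical rather than supercritical; used by
AxisShielding away from the axis. Proof needs decay/boundedness of Γ(t) at spatial infinity for t >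
0 (parabolic maximum principle on {r > 0} with Γ = 0 on the axis); the grounder may allow named
decay facts as hypotheses. -/
@[route_item "route-NavierStokesRegularity-TokamakQuasistatics"]
def SwirlMaximumPrinciple : Prop :=
  ∀ (ν T : ℝ), 0 < ν → 0 < T → ∀ (u : ℝ → EuclideanSpace ℝ (Fin 3) → EuclideanSpace ℝ (Fin 3)) (p : ℝ → EuclideanSpace ℝ (Fin 3) → ℝ), Literature.Analysis.FluidPDE.IsClassicalNSSolutionOn (Set.Ico 0 T) ν 0 u p → Literature.Analysis.FluidPDE.IsLerayHopfOn T ν 0 (u 0) u → Literature.Analysis.FluidPDE.HasRapidSpatialDecay (u 0) → (∀ t ∈ Set.Ico 0 T, Literature.Analysis.FluidPDE.IsAxisymmetric (u t)) → ∀ t ∈ Set.Ico 0 T, ∀ x, |Literature.Analysis.FluidPDE.swirl (u t) x| ≤ ⨆ y, |Literature.Analysis.FluidPDE.swirl (u 0) y|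

/-- item stmt-NavierStokesRegularity-1678 · support · rank 9 · closed · moot by None · by planner
sources: Fefferman2000, Hou2022PotentiallySingularNS, Gavrilov2019, KNSS2009
[support] NEGATIVE EXIT — VISCOUS GENESIS (= ¬NoBlowupFromEquilibria by pure logic, theorem
viscousGenesis_iff_not_target in the planner's Sketch.lean): some ν > 0 and some rapidly decaying
axisymmetric steady Euler datum launch a classical Leray–Hopf solution that is MAXIMAL with finite
lifespan T (IsMaximalSmoothSolution ν 0 u p T). It is an X5a witness
(stmt-NavierStokesRegularity-0152 shape plus steadiness of u 0), hence with Clay-class uniqueness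
X5b (stmt-…-0153) gives ¬NavierStokesRegularity through the accepted `Literature.NS.blowup_assembly`
(stmt-…-0151): a singularity CREATED by viscosity from a flow Euler holds still, necessarily Type II
(Literature.Barriers.NavierStokesRegularity.AxisymmetricTypeIExclusion). Not staffed as a
construction target now (no scenario); kit evidence (axisymmetric DNS from A·u_G, Rayleigh
discriminant of Gavrilov's profile) attaches here. The card's softer transition branch (leaving
every o(A)-neighbourhood of the equilibrium manifold in O(τ_relax)) is the expected precursor and
would make LaminarDissipation/ViscousWindow suspect-false first. -/
@[route_item "route-NavierStokesRegularity-TokamakQuasistatics"]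
def ViscousGenesis : Prop :=
  ∃ ν : ℝ, 0 < ν ∧ ∃ T : ℝ, 0 < T ∧ ∃ (u : ℝ → EuclideanSpace ℝ (Fin 3) → EuclideanSpace ℝ (Fin 3)) (p : ℝ → EuclideanSpace ℝ (Fin 3) → ℝ), Literature.Analysis.FluidPDE.IsMaximalSmoothSolution ν 0 u p T ∧ Literature.Analysis.FluidPDE.IsLerayHopfOn T ν 0 (u 0) u ∧ Literature.Analysis.FluidPDE.HasRapidSpatialDecay (u 0) ∧ Literature.Analysis.FluidPDE.IsAxisymmetric (u 0) ∧ ∃ p₀ : EuclideanSpace ℝ (Fin 3) → ℝ, ContDiff ℝ (⊤ : ℕ∞) p₀ ∧ ∀ x, Literature.Analysis.FluidPDE.convect (u 0) (u 0) x = -gradient p₀ x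

/-- item stmt-NavierStokesRegularity-1679 · support · rank 9 · closed · moot by None · by planner
sources: Fefferman2000, Leray1934
[support] CLAY (A) VERBATIM ON 𝔈_ax: Fefferman's statement (A)
(`Literature.NS.NavierStokesExistenceSmoothR3` shape: ∃ jointly smooth (u,p) on ℝ³×[0,∞) solving NS
with datum u₀ and bounded energy) for every smooth divergence-free rapidly decaying datum that is
axisymmetric and steady Euler. Follows from the Target NoBlowupFromEquilibria by the local theory
exactly as the shared item stmt-NavierStokesRegularity-0055 (NoBlowup → NavierStokesRegularity):
local classical Leray–Hopf existence from smooth rapidly decaying data, continuation past every T,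
weak–strong uniqueness gluing, energy inequality,
`Literature.Analysis.FluidPDE.isNavierStokesSolution_and_smooth_iff`; may take the same named facts
as hypotheses if the grounder so rules. -/
@[route_item "route-NavierStokesRegularity-TokamakQuasistatics"]
def ClayOnEquilibria : Prop :=
  ∀ ν : ℝ, 0 < ν → ∀ u₀ : EuclideanSpace ℝ (Fin 3) → EuclideanSpace ℝ (Fin 3), ContDiff ℝ (⊤ : ℕ∞) u₀ → Literature.Analysis.FluidPDE.NSWave0.IsDivFree u₀ → Literature.Analysis.FluidPDE.HasRapidSpatialDecay u₀ → Literature.Analysis.FluidPDE.IsAxisymmetric u₀ → (∃ p₀ : EuclideanSpace ℝ (Fin 3) → ℝ, ContDiff ℝ (⊤ : ℕ∞) p₀ ∧ ∀ x, Literature.Analysis.FluidPDE.convect u₀ u₀ x = -gradient p₀ x) → ∃ (u : ℝ → EuclideanSpace ℝ (Fin 3) → EuclideanSpace ℝ (Fin 3)) (p : ℝ → EuclideanSpace ℝ (Fin 3) → ℝ), Literature.Analysis.FluidPDE.IsSmoothOnHalfSpace u ∧ Literature.Analysis.FluidPDE.IsSmoothOnHalfSpace p ∧ Literature.Analysis.FluidPDE.IsNavierStokesSolution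 ν 0 u₀ u p ∧ Literature.Analysis.FluidPDE.HasBoundedEnergy u

/-- item stmt-NavierStokesRegularity-1680 · assembly · rank 1 · closed · moot by None · by planner
sources: LeiZhang2017, Fefferman2000
[assembly] AxisCriterion → AxisShielding → NoBlowupFromEquilibria. PURE LOGIC (theorem
assembly_holds in the planner's Sketch.lean, 3 lines): given the Target's hypotheses, AxisShielding
yields axisymmetry of all slices and the uniform log-modulus of Γ at the axis; AxisCriterion turns
these into HasSmoothExtensionPast. -/
@[route_item "route-NavierStokesRegularity-TokamakQuasistatics"]
def Assembly : Prop :=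
  (∀ (ν T : ℝ), 0 < ν → 0 < T → ∀ (u : ℝ → EuclideanSpace ℝ (Fin 3) → EuclideanSpace ℝ (Fin 3)) (p : ℝ → EuclideanSpace ℝ (Fin 3) → ℝ), Literature.Analysis.FluidPDE.IsClassicalNSSolutionOn (Set.Ico 0 T) ν 0 u p → Literature.Analysis.FluidPDE.IsLerayHopfOn T ν 0 (u 0) u → Literature.Analysis.FluidPDE.HasRapidSpatialDecay (u 0) → (∀ t ∈ Set.Ico 0 T, Literature.Analysis.FluidPDE.IsAxisymmetric (u t)) → (∃ C r₁ : ℝ, 0 < r₁ ∧ ∀ t ∈ Set.Ico 0 T, ∀ x, 0 < Literature.Analysis.FluidPDE.cylRadius x → Literature.Analysis.FluidPDE.cylRadius x ≤ r₁ / 4 → |Literature.Analysis.FluidPDE.swirl (u t) x| ≤ C * (Real.log (r₁ / Literature.Analysis.FluidPDE.cylRadius x))⁻¹ ^ 2) → Literature.Analysis.FluidPDE.HasSmoothExtensionPast ν 0 u T) → (∀ (ν T : ℝ), 0 < ν → 0 < T → ∀ (u : ℝ → EuclideanSpace ℝ (Fin 3) → EuclideanSpace ℝ (Fin 3)) (p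 : ℝ → EuclideanSpace ℝ (Fin 3) → ℝ), Literature.Analysis.FluidPDE.IsClassicalNSSolutionOn (Set.Ico 0 T) ν 0 u p → Literature.Analysis.FluidPDE.IsLerayHopfOn T ν 0 (u 0) u → Literature.Analysis.FluidPDE.HasRapidSpatialDecay (u 0) → Literature.Analysis.FluidPDE.IsAxisymmetric (u 0) → (∃ p₀ : EuclideanSpace ℝ (Fin 3) → ℝ, ContDiff ℝ (⊤ : ℕ∞) p₀ ∧ ∀ x, Literature.Analysis.FluidPDE.convect (u 0) (u 0) x = -gradient p₀ x) → (∀ t ∈ Set.Ico 0 T, Literature.Analysis.FluidPDE.IsAxisymmetric (u t)) ∧ ∃ C r₁ : ℝ, 0 < r₁ ∧ ∀ t ∈ Set.Ico 0 T, ∀ x, 0 < Literature.Analysis.FluidPDE.cylRadius x → Literature.Analysis.FluidPDE.cylRadius x ≤ r₁ / 4 → |Literature.Analysis.FluidPDE.swirl (u t) x| ≤ C * (Real.log (r₁ / Literature.Analysis.FluidPDE.cylRadius x))⁻¹ ^ 2) → (∀ (ν T : ℝ), 0 < ν → 0 < T → ∀ (u : ℝ → EuclideanSpace ℝ (Fin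 3) → EuclideanSpace ℝ (Fin 3)) (p : ℝ → EuclideanSpace ℝ (Fin 3) → ℝ), Literature.Analysis.FluidPDE.IsClassicalNSSolutionOn (Set.Ico 0 T) ν 0 u p → Literature.Analysis.FluidPDE.IsLerayHopfOn T ν 0 (u 0) u → Literature.Analysis.FluidPDE.HasRapidSpatialDecay (u 0) → Literature.Analysis.FluidPDE.IsAxisymmetric (u 0) → (∃ p₀ : EuclideanSpace ℝ (Fin 3) → ℝ, ContDiff ℝ (⊤ : ℕ∞) p₀ ∧ ∀ x, Literature.Analysis.FluidPDE.convect (u 0) (u 0) x = -gradient p₀ x) → Literature.Analysis.FluidPDE.HasSmoothExtensionPast ν 0 u T)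

end Summit.NavierStokesRegularity.NavierStokesRegularity.Theses.TokamakQuasistatics
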